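import Mathlib
import HarnessLib
import Literature.Geometry.DiscreteGeometry.BondGraph
import Literature.Geometry.DiscreteGeometry.KissingPatterns
import Summits.AtomisticToContinuum.Crystallization.Theses.PricedLinkCensus

/-!
# `SoftFourRings` reduces to a statement about twelve points

Route `PricedLinkCensus`, item `SoftFourRings` (stmt-AtomisticToContinuum-14234): the effective soft
link theorem (Flatley–Theil 2015, Prop. 3.3 in ring form, made effective at tolerance `η ≤ 1/100`
with matching radius `nn_i / 4`).

This helper file isolates the geometric core.  `IsChargeFree η y i` speaks about the whole
configuration `y : Fin N → ℝ³` through the scale-free bond graph, but everything it says about the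
site `i` is carried by thirteen points and twelve numbers: the centre `c = y i`, its scale
`s = nn_i`, the twelve bond-neighbours `z j` and their own scales `n j = nn_{z j}`.  They satisfy

* `s ≤ dist c (z j)` (no site is closer to `i` than `nn_i`),
* `dist c (z j) ≤ (1 + η) · min s (n j)` (the bond `i ∼ z j`),
* `n j ≤ dist (z j) c` and `n j ≤ dist (z j) (z k)` (`nn_{z j}` is below every distance from `z j`),
* for every `j` exactly four `k ≠ j` have `dist (z j) (z k) ≤ (1 + η) · min (n j) (n k)` (ring
  number `4` of the bond `{i, z j}` = degree `4` of `z j` in the link),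

and the conclusion of `SoftFourRings` only asks for sites near the rotated, scaled pattern — the
twelve neighbours are sites.  `softFourRings_of_twelve` proves `SoftFourRings` from the
corresponding statement about such thirteen-point data (the degenerate scale `nn_i = 0` is
dispatched separately: then `y i` itself is within `0` of every pattern point).  Conversely every
such datum is the link of a charge-free site of a finite configuration (add, for each `j`, one far
site at distance `n j` from `z j` radially outward), so nothing is lost; that direction is not
formalised here.

No new definitions; the twelve-point statement is written out as the hypothesis.
-/

namespace Summit.AtomisticToContinuum.Crystallization.Theorems

open Literature.Geometry.DiscreteGeometry

/-- **Reduction of `SoftFourRings` to twelve points.**  If for every `η ∈ (0, 1/100]`, every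
centre `c`, scale `s > 0`, twelve points `z : Fin 12 → ℝ³` and scales `n : Fin 12 → ℝ` with
`s ≤ dist c (z j) ≤ (1 + η) min s (n j)`, `n j ≤ dist (z j) c`, `n j ≤ dist (z j) (z k)` (`j ≠ k`)
and the soft link `{j ∼ k ⇔ dist (z j) (z k) ≤ (1 + η) min (n j) (n k)}` `4`-regular, some linear
isometry `A` and pattern `P ∈ {fcc, hcp}` put every `c + s • A p` within `s / 4` of some `z j` —
then `SoftFourRings` holds: apply it to the twelve bond-neighbours of a charge-free site `i`
(`c = y i`, `s = nn_i`, `n j` their nearest-neighbour distances); if `nn_i = 0` the site `i`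
itself matches every pattern point. -/
theorem softFourRings_of_twelve
    (H : ∀ η : ℝ, 0 < η → η ≤ 1 / 100 →
      ∀ (c : EuclideanSpace ℝ (Fin 3)) (s : ℝ), 0 < s →
      ∀ (z : Fin 12 → EuclideanSpace ℝ (Fin 3)) (n : Fin 12 → ℝ),
        (∀ j, s ≤ dist c (z j)) →
        (∀ j, dist c (z j) ≤ (1 + η) * min s (n j)) →
        (∀ j, n j ≤ dist (z j) c) →
        (∀ j k, j ≠ k → n j ≤ dist (z j) (z k)) →
        (∀ j, (Finset.univ.filter (fun k : Fin 12 =>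
            k ≠ j ∧ dist (z j) (z k) ≤ (1 + η) * min (n j) (n k))).card = 4) →
        ∃ (A : EuclideanSpace ℝ (Fin 3) →ₗᵢ[ℝ] EuclideanSpace ℝ (Fin 3))
          (P : Finset (EuclideanSpace ℝ (Fin 3))),
          (P = fccKissingPattern ∨ P = hcpKissingPattern) ∧
            ∀ p ∈ P, ∃ j : Fin 12, dist (z j) (c + s • A p) ≤ s / 4) :
    Summit.AtomisticToContinuum.Crystallization.Theses.PricedLinkCensus.SoftFourRings := by
  unfold Summit.AtomisticToContinuum.Crystallization.Theses.PricedLinkCensus.SoftFourRings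
  intro η hη hη1 N y i hcf
  rcases (nearestDist_nonneg y i).eq_or_lt with h0 | hpos
  · -- degenerate scale: `y i` itself is within `0 = nn_i / 4` of every pattern point
    refine ⟨LinearIsometry.id, fccKissingPattern, Or.inl rfl, fun p _ => ⟨i, ?_⟩⟩
    rw [← h0, zero_smul, add_zero, dist_self, zero_div]
  · -- enumerate the twelve bond-neighbours of `i`
    set S : Set (Fin N) := (bondGraph η y).neighborSet i with hS
    have hfin : S.Finite := hcf.finite_neighborSet
    haveI : Finite S := hfin.to_subtype
    have hcard : Nat.card S = 12 := by rw [Nat.card_coe_set_eq]; exact hcf.1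
    set e : S ≃ Fin 12 := Finite.equivFinOfCardEq hcard with he
    set idx : Fin 12 → Fin N := fun k => ((e.symm k : S) : Fin N) with hidx
    have hidx_mem : ∀ k, idx k ∈ S := fun k => (e.symm k).2
    have hidx_inj : Function.Injective idx :=
      Subtype.val_injective.comp e.symm.injective
    have hidx_e : ∀ (x : Fin N) (hx : x ∈ S), idx (e ⟨x, hx⟩) = x := fun x hx => by
      simp [hidx]
    have hne_i : ∀ k, i ≠ idx k := fun k => (mem_neighborSet_bondGraph.1 (hidx_mem k)).1
    -- the five hypotheses of `H`
    have h1 : ∀ k, nearestDist y i ≤ dist (y i) (y (idx k)) := fun k =>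
      nearestDist_le_dist y (hne_i k).symm
    have h2 : ∀ k, dist (y i) (y (idx k)) ≤
        (1 + η) * min (nearestDist y i) (nearestDist y (idx k)) := fun k =>
      (mem_neighborSet_bondGraph.1 (hidx_mem k)).2
    have h3 : ∀ k, nearestDist y (idx k) ≤ dist (y (idx k)) (y i) := fun k =>
      nearestDist_le_dist y (hne_i k)
    have h4 : ∀ j k : Fin 12, j ≠ k → nearestDist y (idx j) ≤ dist (y (idx j)) (y (idx k)) :=
      fun j k hjk => nearestDist_le_dist y (fun h => hjk (hidx_inj h).symm)
    have h5 : ∀ j : Fin 12, (Finset.univ.filter (fun k : Fin 12 => k ≠ j ∧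
        dist (y (idx j)) (y (idx k)) ≤
          (1 + η) * min (nearestDist y (idx j)) (nearestDist y (idx k)))).card = 4 := by
      intro j
      have hring : ringNumber η y i (idx j) = 4 := hcf.2 (idx j) (hidx_mem j)
      have himage : (bondGraph η y).neighborSet i ∩ (bondGraph η y).neighborSet (idx j) =
          idx '' ((Finset.univ.filter (fun k : Fin 12 => k ≠ j ∧
            dist (y (idx j)) (y (idx k)) ≤
              (1 + η) * min (nearestDist y (idx j)) (nearestDist y (idx k)))) :
                Set (Fin 12)) := by
        ext x
        simp only [Set.mem_inter_iff, Set.mem_image, Finset.coe_filter, Finset.mem_univ, true_and,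
          Set.mem_setOf_eq]
        constructor
        · rintro ⟨hxS, hxj⟩
          obtain ⟨hne, hdist⟩ := mem_neighborSet_bondGraph.1 hxj
          refine ⟨e ⟨x, hxS⟩, ⟨?_, ?_⟩, hidx_e x hxS⟩
          · intro heq
            apply hne
            rw [← hidx_e x hxS, heq]
          · rw [hidx_e x hxS]
            exact hdist
        · rintro ⟨k, ⟨hkj, hdist⟩, rfl⟩
          exact ⟨hidx_mem k, mem_neighborSet_bondGraph.2
            ⟨fun h => hkj (hidx_inj h).symm, hdist⟩⟩
      rw [ringNumber_def, himage, Set.ncard_image_of_injective _ hidx_inj,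
        Set.ncard_coe_finset] at hring
      exact hring
    obtain ⟨A, P, hP, hmatch⟩ := H η hη hη1 (y i) (nearestDist y i) hpos (fun k => y (idx k))
      (fun k => nearestDist y (idx k)) h1 h2 h3 h4 h5
    exact ⟨A, P, hP, fun p hp => by
      obtain ⟨j, hj⟩ := hmatch p hp
      exact ⟨idx j, hj⟩⟩

/-- **Normalised twelve-point form.**  It suffices to treat the centre `0` and the scale `nn_i = 1`:
twelve points `z j` with `1 ≤ ‖z j‖ ≤ (1 + η) min 1 (n j)`, `n j ≤ ‖z j‖`, `n j ≤ dist (z j) (z k)`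
(`j ≠ k`), soft link `4`-regular ⟹ some rotated pattern has every point within `1/4` of some `z j`.
(Translate by `-c` and scale by `s⁻¹`; all hypotheses and the conclusion are homogeneous.) -/
theorem softFourRings_of_twelve_unit
    (H : ∀ η : ℝ, 0 < η → η ≤ 1 / 100 →
      ∀ (z : Fin 12 → EuclideanSpace ℝ (Fin 3)) (n : Fin 12 → ℝ),
        (∀ j, 1 ≤ ‖z j‖) →
        (∀ j, ‖z j‖ ≤ (1 + η) * min 1 (n j)) →
        (∀ j, n j ≤ ‖z j‖) →
        (∀ j k, j ≠ k → n j ≤ dist (z j) (z k)) →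
        (∀ j, (Finset.univ.filter (fun k : Fin 12 =>
            k ≠ j ∧ dist (z j) (z k) ≤ (1 + η) * min (n j) (n k))).card = 4) →
        ∃ (A : EuclideanSpace ℝ (Fin 3) →ₗᵢ[ℝ] EuclideanSpace ℝ (Fin 3))
          (P : Finset (EuclideanSpace ℝ (Fin 3))),
          (P = fccKissingPattern ∨ P = hcpKissingPattern) ∧
            ∀ p ∈ P, ∃ j : Fin 12, dist (z j) (A p) ≤ 1 / 4) :
    Summit.AtomisticToContinuum.Crystallization.Theses.PricedLinkCensus.SoftFourRings := by
  refine softFourRings_of_twelve fun η hη hη1 c s hs z n h1 h2 h3 h4 h5 => ?_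
  have hs' : 0 < s⁻¹ := inv_pos.2 hs
  -- normalised data
  set z' : Fin 12 → EuclideanSpace ℝ (Fin 3) := fun j => s⁻¹ • (z j - c) with hz'
  set n' : Fin 12 → ℝ := fun j => s⁻¹ * n j with hn'
  have hnorm : ∀ j, ‖z' j‖ = s⁻¹ * dist (z j) c := fun j => by
    rw [hz', norm_smul, Real.norm_eq_abs, abs_of_pos hs', dist_eq_norm]
  have hdist : ∀ j k, dist (z' j) (z' k) = s⁻¹ * dist (z j) (z k) := fun j k => by
    rw [hz', dist_smul₀, Real.norm_eq_abs, abs_of_pos hs', dist_sub_right]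
  have hmin : ∀ j k, min (n' j) (n' k) = s⁻¹ * min (n j) (n k) := fun j k => by
    rw [hn', mul_min_of_nonneg _ _ hs'.le]
  have g1 : ∀ j, 1 ≤ ‖z' j‖ := fun j => by
    rw [hnorm, dist_comm, le_inv_mul_iff₀ hs, mul_one]
    exact h1 j
  have g2 : ∀ j, ‖z' j‖ ≤ (1 + η) * min 1 (n' j) := fun j => by
    have : min 1 (n' j) = s⁻¹ * min s (n j) := by
      rw [hn', mul_min_of_nonneg _ _ hs'.le, inv_mul_cancel₀ hs.ne']
    rw [hnorm, this, dist_comm, mul_left_comm]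
    exact mul_le_mul_of_nonneg_left (h2 j) hs'.le
  have g3 : ∀ j, n' j ≤ ‖z' j‖ := fun j => by
    rw [hnorm, hn']
    exact mul_le_mul_of_nonneg_left (h3 j) hs'.le
  have g4 : ∀ j k, j ≠ k → n' j ≤ dist (z' j) (z' k) := fun j k hjk => by
    rw [hdist, hn']
    exact mul_le_mul_of_nonneg_left (h4 j k hjk) hs'.le
  have g5 : ∀ j, (Finset.univ.filter (fun k : Fin 12 =>
      k ≠ j ∧ dist (z' j) (z' k) ≤ (1 + η) * min (n' j) (n' k))).card = 4 := fun j => by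
    rw [← h5 j]
    congr 1
    refine Finset.filter_congr fun k _ => ?_
    rw [hdist, hmin, mul_left_comm, mul_le_mul_iff_right₀ hs']
  obtain ⟨A, P, hP, hmatch⟩ := H η hη hη1 z' n' g1 g2 g3 g4 g5
  refine ⟨A, P, hP, fun p hp => ?_⟩
  obtain ⟨j, hj⟩ := hmatch p hp
  refine ⟨j, ?_⟩
  have hzj : z j = c + s • z' j := by
    rw [hz', smul_smul, mul_inv_cancel₀ hs.ne', one_smul, add_sub_cancel]
  rw [hzj, dist_add_left, dist_smul₀, Real.norm_eq_abs, abs_of_pos hs]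
  calc s * dist (z' j) (A p) ≤ s * (1 / 4) := mul_le_mul_of_nonneg_left hj hs.le
    _ = s / 4 := by ring

/-! ### The angular window of a soft link

Consequences of the hypotheses of the normalised twelve-point form, used by every geometric attack:
with `m = 1 + η`, any two link sites subtend an angle of cosine `≤ 1 − 1/(2m²)` at the centre
(`59.35°` at `η = 1/100`), and two BONDED link sites an angle of cosine `≥ 1 − m²/2` (`60.66°`). -/

/-- **Separation in angle.** If `1 ≤ ‖z j‖ ≤ (1 + η) min 1 (n j)` and `n j ≤ dist (z j) (z k)` for all
`j ≠ k` (and `0 ≤ η ≤ 1/2`), then `⟪z j, z k⟫ ≤ (1 − 1/(2(1+η)²)) ‖z j‖ ‖z k‖` for `j ≠ k`: the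
directions of two link sites are at least `arccos (1 − 1/(2(1+η)²))` apart. (From
`dist² = ‖z j‖² + ‖z k‖² − 2⟪z j, z k⟫`, `dist ≥ max ‖·‖/(1+η)` and `1 ≤ ‖·‖ ≤ 1 + η`.) -/
theorem inner_le_of_link {η : ℝ} (hη : 0 ≤ η) (hη2 : η ≤ 1 / 2)
    {z : Fin 12 → EuclideanSpace ℝ (Fin 3)} {n : Fin 12 → ℝ}
    (h1 : ∀ j, 1 ≤ ‖z j‖) (h2 : ∀ j, ‖z j‖ ≤ (1 + η) * min 1 (n j))
    (h4 : ∀ j k, j ≠ k → n j ≤ dist (z j) (z k)) {j k : Fin 12} (hjk : j ≠ k) :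
    inner ℝ (z j) (z k) ≤ (1 - 1 / (2 * (1 + η) ^ 2)) * (‖z j‖ * ‖z k‖) := by
  have hm0 : (0 : ℝ) < 1 + η := by linarith
  -- the identity `dist² = ‖z j‖² + ‖z k‖² - 2 ⟪z j, z k⟫`
  have hd : dist (z j) (z k) ^ 2 = ‖z j‖ ^ 2 - 2 * inner ℝ (z j) (z k) + ‖z k‖ ^ 2 := by
    rw [dist_eq_norm, norm_sub_sq_real]
  -- `‖z j‖ ≤ (1+η) dist` and `‖z k‖ ≤ (1+η) dist`
  have hzj : ‖z j‖ ≤ (1 + η) * dist (z j) (z k) :=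
    (h2 j).trans ((mul_le_mul_of_nonneg_left (min_le_right _ _) hm0.le).trans
      (mul_le_mul_of_nonneg_left (h4 j k hjk) hm0.le))
  have hzk : ‖z k‖ ≤ (1 + η) * dist (z j) (z k) := by
    rw [dist_comm]
    exact (h2 k).trans ((mul_le_mul_of_nonneg_left (min_le_right _ _) hm0.le).trans
      (mul_le_mul_of_nonneg_left (h4 k j hjk.symm) hm0.le))
  have hj1 := h1 j
  have hk1 := h1 k
  have hjm : ‖z j‖ ≤ 1 + η :=
    (h2 j).trans ((mul_le_mul_of_nonneg_left (min_le_left _ _) hm0.le).trans (mul_one _).le)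
  have hkm : ‖z k‖ ≤ 1 + η :=
    (h2 k).trans ((mul_le_mul_of_nonneg_left (min_le_left _ _) hm0.le).trans (mul_one _).le)
  set ρ := ‖z j‖ with hρ
  set σ := ‖z k‖ with hσ
  set d := dist (z j) (z k) with hdd
  have hd0 : 0 ≤ d := dist_nonneg
  have hρ0 : 0 ≤ ρ := by linarith
  have hσ0 : 0 ≤ σ := by linarith
  -- `(1+η)² - 1 ≤ 1 + η` because `η ≤ 1/2`
  have hm3 : (1 + η) ^ 2 - 1 ≤ 1 + η := by nlinarith
  -- division-free core: `(1+η)² (ρ² + σ² - d²) ≤ 2 (1+η)² ρ σ - ρ σ`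
  have key : (1 + η) ^ 2 * (ρ ^ 2 + σ ^ 2 - d ^ 2) ≤ 2 * (1 + η) ^ 2 * (ρ * σ) - ρ * σ := by
    rcases le_total σ ρ with hle | hle
    · have s1 : ρ ^ 2 ≤ (1 + η) ^ 2 * d ^ 2 := by nlinarith [hzj]
      have s2 : (1 + η) ^ 2 * (ρ - σ) ≤ ρ := by nlinarith [mul_le_mul_of_nonneg_left hm3 hρ0]
      nlinarith [mul_le_mul_of_nonneg_left s2 (sub_nonneg.2 hle)]
    · have s1 : σ ^ 2 ≤ (1 + η) ^ 2 * d ^ 2 := by nlinarith [hzk]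
      have s2 : (1 + η) ^ 2 * (σ - ρ) ≤ σ := by nlinarith [mul_le_mul_of_nonneg_left hm3 hσ0]
      nlinarith [mul_le_mul_of_nonneg_left s2 (sub_nonneg.2 hle)]
  have h2m : (0 : ℝ) < 2 * (1 + η) ^ 2 := by positivity
  have hfin : inner ℝ (z j) (z k) * (2 * (1 + η) ^ 2) ≤ (2 * (1 + η) ^ 2 - 1) * (ρ * σ) := by
    nlinarith [key, hd]
  have hrw : (1 - 1 / (2 * (1 + η) ^ 2)) * (ρ * σ) =
      (2 * (1 + η) ^ 2 - 1) * (ρ * σ) / (2 * (1 + η) ^ 2) := by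
    field_simp
  rw [hrw, le_div_iff₀ h2m]
  exact hfin

/-- **Bonds in angle.** If moreover `n j ≤ ‖z j‖` and the pair is bonded,
`dist (z j) (z k) ≤ (1 + η) min (n j) (n k)`, then `⟪z j, z k⟫ ≥ (1 − (1+η)²/2) ‖z j‖ ‖z k‖`: bonded
directions are at most `arccos (1 − (1+η)²/2)` apart. -/
theorem le_inner_of_bond {η : ℝ} (hη : 0 ≤ η)
    {z : Fin 12 → EuclideanSpace ℝ (Fin 3)} {n : Fin 12 → ℝ}
    (h3 : ∀ j, n j ≤ ‖z j‖) {j k : Fin 12}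
    (hb : dist (z j) (z k) ≤ (1 + η) * min (n j) (n k)) :
    (1 - (1 + η) ^ 2 / 2) * (‖z j‖ * ‖z k‖) ≤ inner ℝ (z j) (z k) := by
  have hm0 : (0 : ℝ) < 1 + η := by linarith
  have hd : dist (z j) (z k) ^ 2 = ‖z j‖ ^ 2 - 2 * inner ℝ (z j) (z k) + ‖z k‖ ^ 2 := by
    rw [dist_eq_norm, norm_sub_sq_real]
  set ρ := ‖z j‖ with hρ
  set σ := ‖z k‖ with hσ
  set d := dist (z j) (z k) with hdd
  have hd0 : 0 ≤ d := dist_nonneg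
  have hρ0 : 0 ≤ ρ := norm_nonneg _
  have hσ0 : 0 ≤ σ := norm_nonneg _
  have hdρ : d ≤ (1 + η) * ρ :=
    hb.trans (mul_le_mul_of_nonneg_left ((min_le_left _ _).trans (h3 j)) hm0.le)
  have hdσ : d ≤ (1 + η) * σ :=
    hb.trans (mul_le_mul_of_nonneg_left ((min_le_right _ _).trans (h3 k)) hm0.le)
  -- `2⟪⟫ = ρ² + σ² - d² ≥ ρ² + σ² - (1+η)² (min ρ σ)² ≥ (2 - (1+η)²) ρ σ`
  have key : 2 * ((1 - (1 + η) ^ 2 / 2) * (ρ * σ)) ≤ ρ ^ 2 + σ ^ 2 - d ^ 2 := by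
    rcases le_total σ ρ with hle | hle
    · have hd2 : d ^ 2 ≤ (1 + η) ^ 2 * σ ^ 2 := by nlinarith [hdσ]
      -- (ρ - σ)² + (1+η)² σ (ρ - σ) ≥ 0
      nlinarith [mul_nonneg (mul_nonneg (sq_nonneg (1 + η)) hσ0) (sub_nonneg.2 hle), sq_nonneg (ρ - σ)]
    · have hd2 : d ^ 2 ≤ (1 + η) ^ 2 * ρ ^ 2 := by nlinarith [hdρ]
      nlinarith [mul_nonneg (mul_nonneg (sq_nonneg (1 + η)) hρ0) (sub_nonneg.2 hle), sq_nonneg (ρ - σ)]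
  nlinarith [key, hd]

end Summit.AtomisticToContinuum.Crystallization.Theorems
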